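import Literature.NumberTheory.EllipticCurves.LocalTorsionGoodReductionProofs
import Literature.NumberTheory.EllipticCurves.GoodReductionTorsionReductionProofs
import HarnessLib

/-!
# `#E(ℚ_p)[p^k] ≤ p` at a good prime `p ≥ 3`: the `p`-primary torsion of `E(ℚ_p)` injects into
# `Ẽ(𝔽_p)`, whose `p`-part has order `≤ p` (Silverman, *AEC* VII.2.1, VII.3.1, IV.6.1; Ex. 5.10)
# — and the `t ≤ 1` binder of Kim's DEPTH-TWO twin discharged there

Sources: J. H. Silverman, *The Arithmetic of Elliptic Curves*, 2nd ed., GTM 106 (2009)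
[SilvermanAEC2009]: Prop. VII.2.1 (the reduction `E(ℚ_p) → Ẽ(𝔽_p)` is a homomorphism onto, with
kernel `E₁(ℚ_p)`, at a good prime), Prop. VII.3.1 with Thm. IV.6.1 (`E₁(ℚ_p)` has no `p`-torsion for
`p ≥ 3`), Exercise 5.10 (`#Ẽ(𝔽_q) ≤ 2q + 1`); C.-H. Kim, Amer. J. Math. 148 (2026) = arXiv:2203.12159
[Kim2022StructureSelmer], §3.1.1 (PDF p. 15): the exact sequence
`0 → Ê(pℤ_p) → E(ℚ_p) → Ẽ(𝔽_p) → 0` with `Ê(pℤ_p) ≅ ℤ_p`, whence `E(ℚ_p)[p^∞] ↪ Ẽ(𝔽_p)`.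

`Proofs`-style file (THEOREMS ONLY: no definition, no named fact, no instance; D-0026 net debt 0),
sibling of `LocalTorsionGoodReductionProofs` (the case `k = 1` with `p ∤ #Ẽ(𝔽_p)`). What is proved:

> for `W/ℚ` globally minimal elliptic and a prime `p ≥ 3` with `p ∤ Δ_min(W)`, and every `k`,
> `#{Q ∈ W(ℚ_p) | p^k • Q = O} ≤ p`

(`natCard_localPPowTorsion_le_of_good`). Proof, all from results the tree holds: `E₁(ℚ_p)` has no
`p`-power torsion (`eq_zero_of_isInReductionKernel_of_pow_nsmul`, iterating the tree's
`LocalTorsionMult.eq_zero_of_isInReductionKernel_of_prime_nsmul`), so the reduction homomorphism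
(`exists_reductionHom`, kernel `E₁(ℚ_p)` by `reducePoint_congrEquiv_eq_zero_iff`) is injective on
`W(ℚ_p)[p^k]` and lands in the `p`-primary component of `Ẽ(𝔽_p)`; that component is a `p`-group
(`IsPGroup.iff_card`), so its order `p^m` divides `#Ẽ(𝔽_p) = N_p ≤ 2p + 1 < p²`
(`reductionPointCount_le_two_mul_add_one`), forcing `m ≤ 1`.

## Statements
* §1 `eq_zero_of_isInReductionKernel_of_pow_nsmul` (`P ∈ E₁(ℚ_p)`, `p^k • P = O` ⟹ `P = O`, `p ≥ 3`);
  `reductionPointCount_le_two_mul_add_one` (`N_p ≤ 2p + 1`, every `p`), `reductionPointCount_lt_sq`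
  (`N_p < p²`, `p ≥ 3`).
* §2 `natCard_localPPowTorsion_le_of_good` (the display above); `natCard_localPSqTorsion_le_of_good`
  (`k = 2`, hypothesis `W.HasGoodReductionAtPrime p`) — LITERALLY the binder
  `Nat.card {Q : (W.baseChange ℚ_[p]).toAffine.Point // (p ^ 2 : ℕ) • Q = 0} ≤ p` ("`t ≤ 1`") of the
  DEPTH-TWO twin `Kim2022_rankZero_padicValRat_sha_of_kuriharaNumber_ne_zero_of_maninConstant_depthTwo`
  (`KuriharaNumberKimShaLengthLocalTorsionTrivial`, ARM P TY-QUEUE 11c; reader bsd-cited-r10 ADDENDUM-2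
  sha16 2c7193b026c59569 P2: "true on EVERY good … row at `p ≥ 5` by an elementary argument … not yet
  a tree lemma, hence a binder" — it is a tree lemma now).
* §3 CONSUMER — `Kim2022_rankZero_padicValRat_sha_of_kuriharaNumber_ne_zero_of_maninConstant_depthTwo_of_good`:
  the depth-two twin READ AT A GOOD `p` with the `t ≤ 1` binder discharged (proved; nothing asserted).
  On the rows the twin exists for — good anomalous `p` with a local point of order `p` (`t = 1`), where
  a LEVEL-TWO certificate is consumed (BSD cited-literature audit ARM P, referee A R351.5's exit road)
  — the kernel therefore needs no local `p²`-torsion datum. Nothing is booked here (ARM P, cell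
  `bsd-cited`, 0 classes by design); no `Summits/` file is touched.

## References
* J. H. Silverman, *The Arithmetic of Elliptic Curves*, 2nd ed., GTM 106 (2009), Prop. VII.2.1,
  Prop. VII.3.1, Thm. IV.6.1, Exercise 5.10. [SilvermanAEC2009]
* C.-H. Kim, Amer. J. Math. 148 (2026) = arXiv:2203.12159, §3.1.1 and Prop. 3.2 (PDF p. 15), Thm. 1.9
  (6) (PDF p. 8). [Kim2022StructureSelmer]
-/

noncomputable section

open scoped Classical

open WeierstrassCurve CongruenceSubgroup Literature.NumberTheory.EllipticCurves.ModularForms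

namespace Literature.NumberTheory.EllipticCurves

section LocalPPrimaryTorsionGood

variable (W : WeierstrassCurve ℚ) [W.IsElliptic] [W.IsGloballyMinimal] (p : ℕ) [hp : Fact p.Prime]

/-! ### §1 `E₁(ℚ_p)` has no `p`-power torsion; `N_p ≤ 2p + 1 < p²` -/

/-- **`E₁(ℚ_p)` has no `p`-power torsion for `p ≥ 3`**: a `ℚ_p`-point of `W ⊗ ℚ_p` (`W/ℚ` globally
minimal) in the kernel of reduction with `p^k • P = O` is `O` — the case `k = 1` is the tree's
`LocalTorsionMult.eq_zero_of_isInReductionKernel_of_prime_nsmul` (AEC VII.3.1 with IV.6.1, division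
polynomials), and `E₁(ℚ_p)` is a subgroup (`isInReductionKernel_nsmul`), so induct on `k`.
[cite: SilvermanAEC2009, VII.3 Prop. 3.1 (with IV.6 Thm. 6.1) and VII.2 Prop. 2.2] -/
theorem eq_zero_of_isInReductionKernel_of_pow_nsmul (hp3 : 3 ≤ p) (k : ℕ)
    (P : (W.baseChange ℚ_[p]).toAffine.Point) (hP : (W.baseChange ℚ_[p]).IsInReductionKernel P)
    (h0 : p ^ k • P = 0) : P = 0 := by
  haveI : (W.baseChange ℚ_[p]).IsMinimal ℤ_[p] := isMinimal_map_padic_of_isGloballyMinimal W p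
  haveI : (W.baseChange ℚ_[p]).IsElliptic := by rw [baseChange]; infer_instance
  induction k generalizing P with
  | zero => simpa using h0
  | succ k ih =>
    -- `p^k • P ∈ E₁(ℚ_p)` is killed by `p`, hence is `O`; then induct
    have hk : (W.baseChange ℚ_[p]).IsInReductionKernel (p ^ k • P) :=
      (W.baseChange ℚ_[p]).isInReductionKernel_nsmul hP (p ^ k)
    have hkill : p • (p ^ k • P) = 0 := by
      rw [smul_smul, ← pow_succ', h0]
    exact ih P hP (LocalTorsionMult.eq_zero_of_isInReductionKernel_of_prime_nsmul p hp3
      ((integralModelInt W).map (Int.castRingHom ℤ_[p])) (W.baseChange ℚ_[p])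
      (padicModel_baseChange W p) _ hk hkill)

omit [W.IsElliptic] hp in
/-- **`N_p = #Ẽ(𝔽_p) ≤ 2p + 1`** (two ordinates per abscissa at most, plus `O`; AEC Ex. 5.10; tree
`natCard_point_le_two_mul_card_add_one'` read on the reduction `integralModelInt W mod p`).
[cite: SilvermanAEC2009, Exercise 5.10] -/
theorem reductionPointCount_le_two_mul_add_one [Fact p.Prime] :
    W.reductionPointCount p ≤ 2 * p + 1 := by
  have h := natCard_point_le_two_mul_card_add_one'
    ((integralModelInt W).map (Int.castRingHom (ZMod p)))
  rw [ZMod.card] at h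
  exact h

omit [W.IsElliptic] hp in
/-- `N_p < p²` for `p ≥ 3` (`2p + 1 < p²`). [cite: SilvermanAEC2009, Exercise 5.10] -/
theorem reductionPointCount_lt_sq [Fact p.Prime] (hp3 : 3 ≤ p) : W.reductionPointCount p < p ^ 2 := by
  have h := reductionPointCount_le_two_mul_add_one W p
  have : 2 * p + 1 < p ^ 2 := by nlinarith
  omega

/-! ### §2 `#E(ℚ_p)[p^k] ≤ p` at a good prime `p ≥ 3` -/

/-- **`#{Q ∈ E(ℚ_p) | p^k • Q = O} ≤ p` at a good prime `p ≥ 3`.** For `W/ℚ` globally minimal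
elliptic, `p ≥ 3` with `p ∤ Δ_min(W)`, and any `k`: the `p^k`-torsion of `W(ℚ_p)` has at most `p`
elements. Proof: the reduction homomorphism `r : W(ℚ_p) → Ẽ(𝔽_p)` (AEC VII.2.1, tree
`exists_reductionHom`, kernel `E₁(ℚ_p)` by `reducePoint_congrEquiv_eq_zero_iff`) is injective on
`W(ℚ_p)[p^k]` (§1: `E₁(ℚ_p)` has no `p`-power torsion) and maps it into the `p`-primary component of
`Ẽ(𝔽_p)`, a `p`-group (`IsPGroup.iff_card`) whose order `p^m` divides `N_p < p²` (§1), so `p^m ≤ p`.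
This is Kim's "`E(ℚ_p)[p^∞] ↪ Ẽ(𝔽_p)`" (§3.1.1) with the count made explicit; in Kim's notation
`t = ord_p #E(ℚ_p)[p^∞] ≤ 1` at every good `p ≥ 3`.
[cite: SilvermanAEC2009, VII.2 Prop. 2.1, VII.3 Prop. 3.1 (with IV.6 Thm. 6.1), Exercise 5.10]
[cite: Kim2022StructureSelmer, §3.1.1 (PDF p. 15)] -/
theorem natCard_localPPowTorsion_le_of_good (hp3 : 3 ≤ p)
    (hΔ : ¬ (p : ℤ) ∣ W.minimalDiscriminantInt) (k : ℕ) :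
    Nat.card {Q : (W.baseChange ℚ_[p]).toAffine.Point // (p ^ k : ℕ) • Q = 0} ≤ p := by
  obtain ⟨r, hr⟩ := exists_reductionHom (W := W) (q := p) hΔ
  have hker : ∀ Q, r Q = 0 ↔ (W.baseChange ℚ_[p]).IsInReductionKernel Q := fun Q ↦ by
    rw [hr Q]; exact reducePoint_congrEquiv_eq_zero_iff hΔ Q
  -- the target `Ẽ(𝔽_p)`: finite, of order `N_p < p²`
  set G := (((integralModelInt W).map (Int.castRingHom ℤ_[p])).map
    (IsLocalRing.residue ℤ_[p])).toAffine.Point with hG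
  have hcardG : Nat.card G = W.reductionPointCount p := natCard_point_padicModel_residue W p
  haveI : Finite G :=
    Nat.finite_of_card_ne_zero (by rw [hcardG]; exact (W.reductionPointCount_pos p).ne')
  -- its `p`-primary component `Gp` has order `p^m ≤ p`
  set Gp := AddCommGroup.primaryComponent G p with hGp
  have hP : IsPGroup p (Multiplicative Gp) := by
    intro g
    obtain ⟨n, hn⟩ := (AddCommGroup.mem_primaryComponent).1 (Multiplicative.toAdd g).2
    refine ⟨n, Multiplicative.toAdd.injective ?_⟩
    rw [toAdd_pow, toAdd_one]
    exact Subtype.ext (by simpa using hn)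
  obtain ⟨m, hm0⟩ := IsPGroup.iff_card.1 hP
  have hm : Nat.card Gp = p ^ m := hm0
  have hGp_le : Nat.card Gp ≤ p := by
    have hdvd : Nat.card Gp ∣ Nat.card G :=
      Dvd.intro_left _ Gp.card_eq_card_quotient_mul_card_addSubgroup.symm
    have hpos : 0 < Nat.card G := by rw [hcardG]; exact W.reductionPointCount_pos p
    have hlt : p ^ m < p ^ 2 := by
      rw [← hm]
      exact lt_of_le_of_lt (Nat.le_of_dvd hpos hdvd) (hcardG ▸ reductionPointCount_lt_sq W p hp3)
    have hm1 : m ≤ 1 := by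
      have := (Nat.pow_lt_pow_iff_right hp.out.one_lt).mp hlt
      omega
    rw [hm]
    calc p ^ m ≤ p ^ 1 := Nat.pow_le_pow_right hp.out.pos hm1
      _ = p := pow_one p
  -- `W(ℚ_p)[p^k] ↪ Gp` by reduction
  have hmem : ∀ Q : {Q : (W.baseChange ℚ_[p]).toAffine.Point // (p ^ k : ℕ) • Q = 0}, r Q.1 ∈ Gp := by
    intro Q
    rw [hGp, AddCommGroup.mem_primaryComponent]
    exact ⟨k, by rw [← map_nsmul, Q.2, map_zero]⟩
  let f : {Q : (W.baseChange ℚ_[p]).toAffine.Point // (p ^ k : ℕ) • Q = 0} → Gp :=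
    fun Q ↦ ⟨r Q.1, hmem Q⟩
  have hf : Function.Injective f := by
    intro Q Q' h
    have hQQ' : r Q.1 = r Q'.1 := congrArg (fun x : Gp ↦ (x : G)) h
    have hD : r (Q.1 - Q'.1) = 0 := by rw [map_sub, hQQ', sub_self]
    have h0 : p ^ k • (Q.1 - Q'.1) = 0 := by rw [nsmul_sub, Q.2, Q'.2, sub_self]
    exact Subtype.ext (sub_eq_zero.mp
      (eq_zero_of_isInReductionKernel_of_pow_nsmul W p hp3 k _ ((hker _).mp hD) h0))
  exact (Nat.card_le_card_of_injective f hf).trans hGp_le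

/-- **`#E(ℚ_p)[p²] ≤ p` at a good `p ≥ 3`** in the currency of the tree's class theorems
(`W.HasGoodReductionAtPrime p` ⟹ `p ∤ Δ_min`, tree `not_dvd_minimalDiscriminantInt_of_hasGoodReductionAtPrime'`)
— literally the `t ≤ 1` binder of the depth-two twin
`Kim2022_rankZero_padicValRat_sha_of_kuriharaNumber_ne_zero_of_maninConstant_depthTwo`.
[cite: SilvermanAEC2009, VII.2 Prop. 2.1, VII.3 Prop. 3.1, VII.5 Prop. 5.1(a), Exercise 5.10]
[cite: Kim2022StructureSelmer, §3.1.1 and Prop. 3.2 (PDF p. 15)] -/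
theorem natCard_localPSqTorsion_le_of_good (hp3 : 3 ≤ p) (hgood : W.HasGoodReductionAtPrime p) :
    Nat.card {Q : (W.baseChange ℚ_[p]).toAffine.Point // (p ^ 2 : ℕ) • Q = 0} ≤ p :=
  natCard_localPPowTorsion_le_of_good W p hp3
    (not_dvd_minimalDiscriminantInt_of_hasGoodReductionAtPrime' W p hgood) 2

end LocalPPrimaryTorsionGood

/-! ### §3 Consumer: the depth-two twin at a good `p` -/

/-- **B7 DEPTH-TWO twin at a GOOD `p`** — C.-H. Kim, Amer. J. Math. 148, Thm. 1.8 (6), analytic rank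
`0`, a UNIT Kurihara number at a level `n ∈ 𝒩_2`, in the form
`Kim2022_rankZero_padicValRat_sha_of_kuriharaNumber_ne_zero_of_maninConstant_depthTwo` (ARM P
TY-QUEUE 11c) with its `t ≤ 1` binder `#E(ℚ_p)[p²] ≤ p` DISCHARGED by `W.HasGoodReductionAtPrime p`
(`natCard_localPSqTorsion_le_of_good`). These are exactly the rows the twin is for (good anomalous `p`
with a local point of order `p`, `t = 1`; BSD cited-literature audit, referee A R351.5's exit road
through a level-two certificate). Proved (a reading of the twin; nothing asserted).
[cite: Kim2022StructureSelmer, Thm. 1.9 (6) (PDF p. 8), §3.1.1 and Prop. 3.2 (PDF p. 15)]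
[cite: SilvermanAEC2009, VII.3 Prop. 3.1 and Exercise 5.10] -/
theorem Kim2022_rankZero_padicValRat_sha_of_kuriharaNumber_ne_zero_of_maninConstant_depthTwo_of_good
    (h : Kim2022_rankZero_padicValRat_sha_of_kuriharaNumber_ne_zero_of_maninConstant_depthTwo) :
    ∀ (W : WeierstrassCurve ℚ) [W.IsElliptic] [W.IsGloballyMinimal] (p : ℕ) [Fact p.Prime],
    5 ≤ p → W.HasGoodReductionAtPrime p → W.HasSurjectiveModNGaloisRep p →
    W.entireLFunction 1 ≠ 0 → Finite W.sha →
    ∀ {N : ℕ} [NeZero N] (D : ModularParametrizationData W N),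
    ¬ (p : ℤ) ∣ D.maninConstant →
    (∃ u : ℚ, ‖(u : ℚ_[p])‖ = 1 ∧ W.realPeriodRat = u * plusPeriod D.f) →
    ∀ (n : ℕ) [NeZero n], Kato.IsKolyvaginProduct W p 2 n →
    (∀ (ℓ : ℕ) [Fact ℓ.Prime], ℓ ∣ n →
      Nat.card {P : ((WeierstrassCurve.integralModelInt W).map
          (Int.castRingHom (ZMod ℓ))).toAffine.Point // p • P = 0} ≤ p) →
    ∀ ψ : (ℓ : ℕ) → (ZMod ℓ)ˣ →* Multiplicative (ZMod (p ^ 1)),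
      (∀ ℓ ∈ n.primeFactors, Function.Surjective (ψ ℓ)) →
      kuriharaNumber D.f (p ^ 1) n ψ ≠ 0 →
    ∃ q : ℚ, W.entireLFunction 1 / (W.realPeriodRat : ℂ) = (q : ℂ) ∧
      padicValRat p q = (padicValNat p (Nat.card (AddCommGroup.primaryComponent W.sha p)) : ℤ) :=
  fun W _ _ p _ hp hgood hsurj hL hfin _ _ D hc hu n _ hn hcyc ψ hψ hδ ↦
    h W p hp hsurj (natCard_localPSqTorsion_le_of_good W p (by omega) hgood) hL hfin D hc hu n hn
      hcyc ψ hψ hδ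

end Literature.NumberTheory.EllipticCurves

end
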